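import Summits.HubbardSuperconductivity.HubbardSuperconductivity.Theorems.BalabanIRBirGroundStateAverageLRO

/-!
# Crux `BirGroundStateAverageLRO` (item `stmt-HubbardSuperconductivity-2079`): Jensen transfer of smearing bounds to subspace averages

First file of the Fermi-surface corner of the crux's regime map (route BalabanIR, target
`Theses.BalabanIR.BirGroundStateAverageLRO`; consumer `Negative/MomentumSmearing.lean`). A state-wise
bound of the shape `Re ⟨v, A v⟩ ≤ α + β √(Σ_k x_k(v)(1 - x_k(v)))`, `x_k(v) = Re ⟨v, N_k v⟩ ∈ [0,1]`
(the pair-field / momentum-smearing inequality of `PairFieldMomentumSmearing.lean` has this shape) is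
NOT linear in the state, so the usual column expansion does not average it over a ground eigenspace.
It nevertheless passes to the average with the AVERAGED occupations, by Cauchy–Schwarz and the
concavity of `x ↦ x(1-x)`:

* `smearing_ge_of_sqrt_bound` — real bookkeeping: `aL⁴ ≤ 32L² + 32L³√S`, `aL² ≥ 64`, `L > 0` `⟹`
  `S ≥ a²L²/4096`;
* `sum_le_card_mul_smearingAverage` — for `d ≥ 1` rows `x_{j·} ∈ [0,1]^ι` and numbers
  `A_j ≤ α + β √(Σ_k x_{jk}(1 - x_{jk}))` (`β ≥ 0`): `Σ_j A_j ≤ d (α + β √(Σ_k x̄_k(1 - x̄_k)))`,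
  `x̄_k = (Σ_j x_{jk})/d`;
* `re_trace_projMatrix_mul_le_smearingAverage` — the same for the projection matrix `P_K` onto any
  subspace `K ≤ ℂ^ν`: `Re tr (P_K A) ≤ Re tr P_K · (α + β √(Σ_k x̄_k(1 - x̄_k)))`,
  `x̄_k = Re tr (P_K N_k)/Re tr P_K` (orthonormal frame `P_K = B Bᴴ`, `exists_orthonormalFrame`,
  `proj_unique`, column expansion of the traces).

Sources: H. Tasaki, Physics and Mathematics of Quantum Many-Body Systems (2020) §2.1, App. A.2
(ground-state averages as traces against the ground projection); G. H. Hardy, J. E. Littlewood,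
G. Pólya, Inequalities (1952) §2.5 (power means). Folklore finite-dimensional statements; no
definition and no named fact is introduced; nothing here asserts a Theses decl.
-/

noncomputable section

namespace Summit.HubbardSuperconductivity.HubbardSuperconductivity.Theorems.BirGroundStateAverageLRO.Negative

set_option linter.dupNamespace false

open Matrix Finset Filter
open Literature.MathematicalPhysics.QuantumLattice
open Literature.Computability.AlgebraicComplexity
open Summit.HubbardSuperconductivity.HubbardSuperconductivity.Theorems
open scoped ComplexOrder

/-! ### §1 Real bookkeeping and the Jensen transfer -/

section Real

/-- `aL⁴ ≤ 32L² + 32L³√S` with `aL² ≥ 64`, `L > 0` forces `S ≥ a²L²/4096` (`32L² ≤ aL⁴/2`, so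
`aL ≤ 64√S`; in particular `S ≥ 0`). [folklore] -/
theorem smearing_ge_of_sqrt_bound {a l S : ℝ} (hl : 0 < l) (h64 : 64 ≤ a * l ^ 2)
    (h : a * l ^ 4 ≤ 32 * l ^ 2 + 32 * l ^ 3 * Real.sqrt S) : a ^ 2 * l ^ 2 / 4096 ≤ S := by
  have hl2 : 0 < l ^ 2 := by positivity
  have hl3 : 0 < l ^ 3 := by positivity
  have ha0 : 0 < a := by
    by_contra ha
    have : a * l ^ 2 ≤ 0 := mul_nonpos_of_nonpos_of_nonneg (not_lt.1 ha) hl2.le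
    linarith
  have h32 : 32 * l ^ 2 ≤ a * l ^ 4 / 2 := by
    have h' := mul_le_mul_of_nonneg_right h64 (show (0 : ℝ) ≤ l ^ 2 / 2 by positivity)
    have e1 : (64 : ℝ) * (l ^ 2 / 2) = 32 * l ^ 2 := by ring
    have e2 : a * l ^ 2 * (l ^ 2 / 2) = a * l ^ 4 / 2 := by ring
    linarith [e1, e2, h']
  have hS0 : 0 ≤ S := by
    by_contra hS
    rw [Real.sqrt_eq_zero'.2 (le_of_lt (not_le.1 hS)), mul_zero, add_zero] at h
    nlinarith
  have hA : a * l * l ^ 3 ≤ 64 * Real.sqrt S * l ^ 3 := by nlinarith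
  have hB : a * l ≤ 64 * Real.sqrt S := le_of_mul_le_mul_right hA hl3
  have hB0 : 0 ≤ a * l := by positivity
  have hsq : (a * l) ^ 2 ≤ (64 * Real.sqrt S) ^ 2 := pow_le_pow_left₀ hB0 hB 2
  have e : (64 * Real.sqrt S) ^ 2 = 4096 * S := by
    rw [mul_pow, Real.sq_sqrt hS0]
    norm_num
  rw [e] at hsq
  rw [div_le_iff₀ (by norm_num : (0 : ℝ) < 4096)]
  nlinarith

/-- **Jensen transfer of the smearing bound to averages.** For `d ≥ 1` "states" `j` with mode
occupations `x_{jk} ∈ [0,1]` and numbers `A_j ≤ α + β √(Σ_k x_{jk}(1 - x_{jk}))` (`β ≥ 0`):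
`Σ_j A_j ≤ d · (α + β √(Σ_k x̄_k (1 - x̄_k)))` with the averaged occupations `x̄_k = (Σ_j x_{jk})/d`
(Cauchy–Schwarz: `(Σ_j √S_j)² ≤ d Σ_j S_j`; concavity: `Σ_j x_{jk}² ≥ d x̄_k²`). [folklore] -/
theorem sum_le_card_mul_smearingAverage {ι : Type*} [Fintype ι] {d : ℕ} (hd : 0 < d)
    (x : Fin d → ι → ℝ) (A : Fin d → ℝ) {α β : ℝ} (hβ : 0 ≤ β)
    (hx : ∀ j k, x j k ∈ Set.Icc (0 : ℝ) 1)
    (h : ∀ j, A j ≤ α + β * Real.sqrt (∑ k, x j k * (1 - x j k))) :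
    ∑ j, A j ≤ (d : ℝ) * (α + β * Real.sqrt (∑ k, (∑ j, x j k) / d * (1 - (∑ j, x j k) / d))) := by
  have hdR : (0 : ℝ) < d := by exact_mod_cast hd
  set S : Fin d → ℝ := fun j => ∑ k, x j k * (1 - x j k) with hS
  set Sbar : ℝ := ∑ k, (∑ j, x j k) / d * (1 - (∑ j, x j k) / d) with hSbar
  have hS0 : ∀ j, 0 ≤ S j := fun j =>
    Finset.sum_nonneg fun k _ => mul_nonneg (hx j k).1 (by linarith [(hx j k).2])
  have hcard : ((Finset.univ : Finset (Fin d)).card : ℝ) = d := by simp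
  -- (1) sum the per-state bounds
  have h1 : ∑ j, A j ≤ (d : ℝ) * α + β * ∑ j, Real.sqrt (S j) := by
    calc ∑ j, A j ≤ ∑ j, (α + β * Real.sqrt (S j)) := Finset.sum_le_sum fun j _ => h j
      _ = (d : ℝ) * α + β * ∑ j, Real.sqrt (S j) := by
          rw [Finset.sum_add_distrib, Finset.sum_const, Finset.card_univ, Fintype.card_fin,
            nsmul_eq_mul, Finset.mul_sum]
  -- (2) Cauchy–Schwarz: `(Σ_j √S_j)² ≤ d Σ_j S_j`
  have h2 : (∑ j, Real.sqrt (S j)) ^ 2 ≤ (d : ℝ) * ∑ j, S j := by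
    have h := sq_sum_le_card_mul_sum_sq (s := (Finset.univ : Finset (Fin d)))
      (f := fun j => Real.sqrt (S j))
    rw [hcard] at h
    refine h.trans (le_of_eq ?_)
    congr 1
    exact Finset.sum_congr rfl fun j _ => Real.sq_sqrt (hS0 j)
  -- (3) concavity: `Σ_j S_j ≤ d · Sbar`
  have h3 : ∑ j, S j ≤ (d : ℝ) * Sbar := by
    have hswap : ∑ j, S j = ∑ k, ∑ j, x j k * (1 - x j k) := by
      rw [hS]
      exact Finset.sum_comm
    rw [hswap, hSbar, Finset.mul_sum]
    refine Finset.sum_le_sum fun k _ => ?_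
    have hcs : (∑ j, x j k) ^ 2 ≤ (d : ℝ) * ∑ j, x j k ^ 2 := by
      have h := sq_sum_le_card_mul_sum_sq (s := (Finset.univ : Finset (Fin d))) (f := fun j => x j k)
      rwa [hcard] at h
    have e1 : ∑ j, x j k * (1 - x j k) = ∑ j, x j k - ∑ j, x j k ^ 2 := by
      rw [← Finset.sum_sub_distrib]
      exact Finset.sum_congr rfl fun j _ => by ring
    have e2 : (d : ℝ) * ((∑ j, x j k) / d * (1 - (∑ j, x j k) / d)) =
        ∑ j, x j k - (∑ j, x j k) ^ 2 / d := by
      field_simp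
    rw [e1, e2, div_eq_mul_inv]
    have h4 : (∑ j, x j k) ^ 2 * (d : ℝ)⁻¹ ≤ ∑ j, x j k ^ 2 := by
      rw [← div_eq_mul_inv, div_le_iff₀ hdR]
      linarith
    linarith
  -- (4) assemble: `Σ_j √S_j ≤ d √Sbar`
  have hSbar0 : 0 ≤ Sbar := by
    have h0 : 0 ≤ ∑ j, S j := Finset.sum_nonneg fun j _ => hS0 j
    nlinarith
  have h5 : ∑ j, Real.sqrt (S j) ≤ (d : ℝ) * Real.sqrt Sbar := by
    have hsq : (∑ j, Real.sqrt (S j)) ^ 2 ≤ ((d : ℝ) * Real.sqrt Sbar) ^ 2 := by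
      calc (∑ j, Real.sqrt (S j)) ^ 2 ≤ (d : ℝ) * ∑ j, S j := h2
        _ ≤ (d : ℝ) * ((d : ℝ) * Sbar) := mul_le_mul_of_nonneg_left h3 hdR.le
        _ = ((d : ℝ) * Real.sqrt Sbar) ^ 2 := by rw [mul_pow, Real.sq_sqrt hSbar0]; ring
    exact (abs_le_of_sq_le_sq' hsq (mul_nonneg hdR.le (Real.sqrt_nonneg _))).2
  calc ∑ j, A j ≤ (d : ℝ) * α + β * ∑ j, Real.sqrt (S j) := h1
    _ ≤ (d : ℝ) * α + β * ((d : ℝ) * Real.sqrt Sbar) := by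
        have := mul_le_mul_of_nonneg_left h5 hβ
        linarith
    _ = (d : ℝ) * (α + β * Real.sqrt Sbar) := by ring

end Real

/-! ### §2 The transfer to projection averages -/

section ProjAverage

variable {ν ι : Type*} [Fintype ν] [DecidableEq ν] [Fintype ι]

/-- **Smearing bound for subspace averages.** Let `K ≤ ℂ^ν`, `P_K` the projection matrix onto (the
Euclidean transport of) `K`, `A` a matrix and `N_k` (`k ∈ ι`) matrices with `Re ⟨v, N_k v⟩ ∈ [0,1]`
on unit vectors of `K`. If every unit `v ∈ K` obeys `Re ⟨v, A v⟩ ≤ α + β √(Σ_k x_k(v)(1 - x_k(v)))`,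
`x_k(v) = Re ⟨v, N_k v⟩`, `β ≥ 0`, then
`Re tr (P_K A) ≤ Re tr P_K · (α + β √(Σ_k x̄_k (1 - x̄_k)))`, `x̄_k = Re tr (P_K N_k)/Re tr P_K`
(orthonormal frame `P_K = B Bᴴ`, column expansion, `sum_le_card_mul_smearingAverage`).
Tasaki (2020) §2.1, App. A.2. [folklore] -/
theorem re_trace_projMatrix_mul_le_smearingAverage (K : Submodule ℂ (ν → ℂ)) (A : Matrix ν ν ℂ)
    (N : ι → Matrix ν ν ℂ) {α β : ℝ} (hβ : 0 ≤ β)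
    (hx : ∀ v ∈ K, star v ⬝ᵥ v = 1 → ∀ k, (star v ⬝ᵥ N k *ᵥ v).re ∈ Set.Icc (0 : ℝ) 1)
    (h : ∀ v ∈ K, star v ⬝ᵥ v = 1 → (star v ⬝ᵥ A *ᵥ v).re ≤
      α + β * Real.sqrt (∑ k, (star v ⬝ᵥ N k *ᵥ v).re * (1 - (star v ⬝ᵥ N k *ᵥ v).re))) :
    (projMatrix (K.map ((WithLp.linearEquiv 2 ℂ (ν → ℂ)).symm :
        (ν → ℂ) →ₗ[ℂ] EuclideanSpace ℂ ν)) * A).trace.re ≤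
      (projMatrix (K.map ((WithLp.linearEquiv 2 ℂ (ν → ℂ)).symm :
        (ν → ℂ) →ₗ[ℂ] EuclideanSpace ℂ ν))).trace.re *
        (α + β * Real.sqrt (∑ k,
          (projMatrix (K.map ((WithLp.linearEquiv 2 ℂ (ν → ℂ)).symm :
              (ν → ℂ) →ₗ[ℂ] EuclideanSpace ℂ ν)) * N k).trace.re /
            (projMatrix (K.map ((WithLp.linearEquiv 2 ℂ (ν → ℂ)).symm :
              (ν → ℂ) →ₗ[ℂ] EuclideanSpace ℂ ν))).trace.re *
          (1 - (projMatrix (K.map ((WithLp.linearEquiv 2 ℂ (ν → ℂ)).symm :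
              (ν → ℂ) →ₗ[ℂ] EuclideanSpace ℂ ν)) * N k).trace.re /
            (projMatrix (K.map ((WithLp.linearEquiv 2 ℂ (ν → ℂ)).symm :
              (ν → ℂ) →ₗ[ℂ] EuclideanSpace ℂ ν))).trace.re))) := by
  obtain ⟨d, B, hd, hBB, hcol, hfix⟩ := exists_orthonormalFrame K
  have hP : projMatrix (K.map ((WithLp.linearEquiv 2 ℂ (ν → ℂ)).symm :
      (ν → ℂ) →ₗ[ℂ] EuclideanSpace ℂ ν)) = B * Bᴴ :=
    proj_unique (projMatrix_isHermitian _) (Matrix.isHermitian_mul_conjTranspose_self B)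
      (fun _ hw => projMatrix_map_mulVec_of_mem K hw) (projMatrix_map_mulVec_mem K) hfix
      (frame_proj_mulVec_mem hcol)
  -- the columns of the frame
  set b : Fin d → (ν → ℂ) := fun j x => B x j with hb
  have hunit : ∀ j, star (b j) ⬝ᵥ (b j) = 1 := by
    intro j
    have := congrFun (congrFun hBB j) j
    simpa [Matrix.mul_apply, Matrix.conjTranspose_apply, dotProduct, Matrix.one_apply] using this
  have hmem : ∀ j, b j ∈ K := hcol
  -- column expansion of `Re tr (B Bᴴ M)`
  have htr : ∀ M : Matrix ν ν ℂ, (B * Bᴴ * M).trace.re = ∑ j, (star (b j) ⬝ᵥ M *ᵥ (b j)).re := by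
    intro M
    rw [Matrix.mul_assoc, Matrix.trace_mul_comm, Matrix.mul_assoc, Matrix.trace]
    simp only [Matrix.diag_apply, Complex.re_sum]
    refine Finset.sum_congr rfl fun j _ => ?_
    simp only [Matrix.mul_apply, Matrix.conjTranspose_apply, dotProduct, Matrix.mulVec,
      Pi.star_apply, hb]
  have htrP : (B * Bᴴ).trace.re = d := by
    rw [frame_proj_trace hBB]
    simp
  rw [hP]
  simp only [htr, htrP]
  rcases Nat.eq_zero_or_pos d with hd0 | hdpos
  · subst hd0
    simp
  · exact sum_le_card_mul_smearingAverage hdpos (fun j k => (star (b j) ⬝ᵥ N k *ᵥ (b j)).re)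
      (fun j => (star (b j) ⬝ᵥ A *ᵥ (b j)).re) hβ (fun j k => hx _ (hmem j) (hunit j) k)
      (fun j => h _ (hmem j) (hunit j))

end ProjAverage

end Summit.HubbardSuperconductivity.HubbardSuperconductivity.Theorems.BirGroundStateAverageLRO.Negative
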